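import Literature.NumberTheory.EllipticCurves.BertoliniDarmonPrasanna2013.DisplayWeightTwo
import Literature.NumberTheory.EllipticCurves.CuspFormLFunction
import Literature.NumberTheory.EllipticCurves.HeegnerPoints
import HarnessLib

/-!
# Bertolini–Darmon–Prasanna 2013, Thm. 5.4 (5.1.12) / (5.1.16) with Prop. 1.12 (1): the explicit
# Waldspurger formula — `L_alg(f,χ⁻¹,0)` is the SQUARE of a linear form in the values `χ_j(𝔞)⁻¹`
# whose coefficients (CM values of `f`) are `χ`-FREE numbers of the Hilbert class field

Trunk T-NT-EC (`Literature/NumberTheory/EllipticCurves`), story `BertoliniDarmonPrasanna2013/` (M. Bertolini,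
H. Darmon, K. Prasanna, *Generalized Heegner cycles and `p`-adic Rankin `L`-series*, Duke Math. J. 162 (2013)
1033–1148; bib key `BertoliniDarmonPrasanna2013`; author version held as `paper:url-39cfb2a03b1d`, displays
re-assembled at the glyph level by bsd-eis-lit g17, `run/shared/lean/pub/bsd-eis/lit/src/bdp13-author/`, read by
this seat on pp. 14, 59, 60). ONE named fact (`def … : Prop`, nothing asserted; D-0014/D-0026 accounting: +1),
stated in the VOCABULARY OF THE SISTER MODULE `DisplayWeightTwo.lean` (bsd-eis: `bdpLalg` = BDP's own
`L_alg(f,χ⁻¹,0)` at `k = 2`, `c = 1`, `χ = φ·𝐍_K`, `heckeIdealValueExtZero` = the ideal values `χ(𝔞)` of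
(4.1.5)) — no new definition. Cell `bsd-stepL` (HOME `run/shared/lean/pub/bsd-stepL/`), seat `bsd-stepL-desc3-p1x`
(WIDTH-LEVER second lane on item `stmt-BirchSwinnertonDyer-19281`); consumer:
`Summits/BirchSwinnertonDyer/BirchSwinnertonDyer/Theorems/ClassRecordThreeOpenValueReciprocityOfWaldspurger.lean`,
which PROVES from this fact the tree's print-derived reciprocity fact
`Literature.NumberTheory.EllipticCurves.bertoliniDarmonPrasanna2013_centralValue_reciprocity`
(`BDPCentralValueReciprocity.lean`) — i.e. the Galois bookkeeping (D1), (D2), (D4), (D5) of that file's module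
docstring becomes a kernel proof, and only the printed square-root SHAPE (5.1.16) + the rationality of the CM
values (Prop. 1.12 (1)) + the class-field-theoretic description of their field (D3)/(D6) remain cited.

## The printed statements (author version pp. 59–60, 14; verbatim, glyph text of record)

* **Theorem 5.4** (p. 59, (5.1.12)). "Let `f` be a normalised eigenform in `S_k(Γ₀(N), ε_f)` and let
  `χ ∈ Σ_cc^{(2)}(𝔑)` be a Hecke character of `K` of infinity type `(k + j, −j)`. Then
  (5.1.12) `C(f,χ,c)·L(f,χ⁻¹,0) = w(f,χ)·(∑_{[𝔞] ∈ Pic(𝒪_c)} χ_j⁻¹(𝔞)·δ_k^j f(𝔞 ∗ (A₀, t, 2πi dw)))²`, where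
  the constants `C(f,χ,c)` and `w(f,χ)` are described in Theorem 4.6 and in equation (5.1.11) respectively."
  (`χ_j := χ N^j`, p. 57; `A₀ = ℂ/𝒪_c`, (5.1.1).)
* **(5.1.15)** (p. 59). "The choice of the differential `ω₀ ∈ Ω¹(A₀/H_c)` determined by (5.1.1) determines a
  complex period `Ω`, defined as the non-zero complex scalar satisfying `ω₀ = Ω · 2πi dw`".
* **The field** (pp. 59–60). "the point `t₀` belongs (by assumption) to the `𝔑`-torsion subgroup of `A₀`, which is
  defined over `H_c`. Let `H'_c` be the abelian extension of `H_c` over which the individual `𝔑`-torsion points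
  of `A₀` are defined, so that in particular the pair `(A₀, t₀)` is defined over `H'_c`. The Galois group of
  `Gal(H'_c/H_c)` is canonically identified with a subgroup of `(ℤ/Nℤ)^×` via its faithful action on `A₀[𝔑]`. Let
  `H̃_c ⊂ H'_c` be the subfield which is fixed by `ker(ε_f)`. Let `F ⊂ ℂ` be the finite extension of `K`
  generated by `H̃_c`, by the values of the Hecke character `χ` on `𝔸_{K,f}^×`, and by the Fourier coefficients
  of `f`."
* **Theorem 5.5** (p. 60). "For all `χ ∈ Σ_cc^{(2)}(𝔑)` of infinity type `(k + j, −j)`, the quantity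
  `L_alg(f,χ⁻¹,0) := w(f,χ)⁻¹C(f,χ,c)·L(f,χ⁻¹,0)/Ω^{2(k+2j)}` belongs to `F`." **Proof** (p. 60, verbatim):
  "By Theorem 5.4, `w(f,χ)⁻¹C(f,χ,c)L(f,χ⁻¹,0) = (∑_{[𝔞]} χ_j⁻¹(𝔞)·δ_k^j f(𝔞 ∗ (A₀,t₀,2πi dw)))² =
  (∑_{[𝔞]} χ_j⁻¹(𝔞)·δ_k^j f(𝔞 ∗ (A₀,t₀,Ω⁻¹ω₀)))² = Ω^{2(k+2j)}(∑_{[𝔞]} χ_j⁻¹(𝔞)·δ_k^j f(𝔞 ∗ (A₀,t₀,ω₀)))²`.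
  It follows from Lemma 1.5 that
  **(5.1.16)** `L_alg(f,χ⁻¹,0) = (∑_{[𝔞] ∈ Pic(𝒪_c)} χ_j⁻¹(𝔞)·Θ^j_Hodge f(𝔞 ∗ (A₀,t₀,ω₀)))²`.
  Part 1 of Proposition 1.12 implies that the terms `Θ^j_Hodge f(𝔞 ∗ (A₀,t₀,ω₀))` belong to `F`. Theorem 5.5
  follows."
* **Proposition 1.12** (p. 14). "Let `(A′,t′,ω′)/F` be a marked elliptic curve with complex multiplication by an
  order in `K`. … (1) The complex number `Θ_Hodge f(A′,t′,ω′)` belongs to `ι_∞(F)`" (for `f ∈ M_k(Γ, F)`;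
  "Part (1) is due to Shimura [Shim1]" = Shimura, Ann. of Math. 102 (1975)).

## What is typed, and why print implies it (`k = 2`, `ε_f = 𝟙`, `c = 1`, `f` the newform of `E/ℚ`)

READING. In (5.1.16) the coefficient `V_𝔞 := Θ^{j}_Hodge f(𝔞 ∗ (A₀,t₀,ω₀))` of `χ_j⁻¹(𝔞)` does NOT depend
on `χ`: it depends on `f`, on `j = n − 1` (in the dictionary (R1) of `DisplayWeightTwo.lean`: `χ = φ·𝐍_K`, `φ` of
tree type `(n, −n)`, `χ_j(𝔞) = φ(𝔞)·N𝔞^{n}` — typed there inside `bdpConstW` as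
`heckeIdealValueExtZero φ 𝔟 * (Ideal.absNorm 𝔟)^n`), on the ideal `𝔞` and on the CM datum `(A₀,t₀,ω₀)`. So
(5.1.16) says: for every `n ≥ 1` there are FINITELY MANY integral ideals `𝔞` (representatives of `Pic(𝒪_K)`
prime to `𝔑`) and `χ`-FREE complex numbers `V_𝔞` with, for EVERY everywhere-unramified `φ` of type `(n, −n)`,
`L_alg = (∑_𝔞 χ_j(𝔞)⁻¹·V_𝔞)²` — and (Prop. 1.12 (1)) every `V_𝔞` lies in a number field `F₀ ⊂ ℂ` that does
not depend on `χ` either. The typed statement ∃-quantifies the family `(𝔞, V_𝔞)` (any finite family of ideals,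
any coefficients in `F₀`) and the auxiliary data of `bdpLalg` (`Ω` of (5.1.15); `w_f` of Lemma 5.2; the pair
`(𝔟, b_N)` of (5.1.6); `#S(f)`), asking of them only what the consumer uses (`≠ 0`, membership in `F₀`): it is
WEAKER than the printed formula (which names all of them) and robust under every orientation of the dictionary
(replacing `φ` by `φ̄ = φ⁻¹`, or `χ_j(𝔞)⁻¹` by `χ_j(𝔞̄)⁻¹`, re-indexes the family `𝔞 ↦ 𝔞̄`; an `n`-th power of a
rational constant is absorbed in `V_𝔞`).
THE FIELD `F₀` (as (D3)/(D6) of `BDPCentralValueReciprocity.lean`, unchanged): the marked curve `𝔞 ∗ (A₀,t₀,ω₀)` is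
defined over `H'_1 = H(A₀[𝔑])`, so `V_𝔞 ∈ H'_1·K_f` by Prop. 1.12 (1); by (4.1.3) (`f(L, a·t) = ε_f(a) f(L,t)`,
p. 34) with `ε_f = 𝟙` the value does not depend on the choice of `t₀` inside `A₀[𝔑]`, i.e. it is fixed by
`Gal(H'_1/H̃_1)`, and `H̃_1 = H_1 = H` (the fixed field of `ker 𝟙` is everything) — this is exactly why BDP's `F` is
generated by `H̃_c` and not by `H'_c`; for the rational newform `K_f = ℚ`. Hence `V_𝔞 ∈ H`, the Hilbert class
field of `K` (embedded in `ℂ` with `A₀`). We take `F₀ := H(i)`: finite over `ℚ`, containing (both conjugate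
images of) `K`, `i`, `w_f = ±1` (Lemma 5.2 for the real newform `f = f^ρ` with `ε_f = 𝟙`: `w_N f = w_f f`,
`w_N² = 1`) and `b_N ∈ 𝒪_K`, and UNRAMIFIED ABOVE EVERY ODD RATIONAL PRIME THAT IS UNRAMIFIED IN `K` — in
particular above every odd prime split in `K` — because `H/K` is unramified (class field theory, Cox 2013
Thm. 8.10 / §9.A) and `ℚ(i)/ℚ` ramifies only at `2`. (`i` is adjoined for the consumer: dividing `C(f,χ,1)` back
out of `L_alg` produces `|d_K|^{1/2} = ∓ i·√d_K` with `√d_K ∈ K`.)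
NOT typed, NOT asserted: the identification of `V_𝔞` with `Θ^{n−1}_Hodge f(𝔞 ∗ (A₀,t₀,ω₀))` (no CM-triple /
Shimura–Maass front in the tree); (5.1.6) `(𝔟, N) = 1`, `𝔟𝔑 = (b_N)`; `#S(f) = 0`; anything at `c > 1`, `k > 2`,
`ε_f ≠ 𝟙`, even `d_K` (Thm. 4.6: "`c` and `d_K` are odd"). Every binder of the antecedent is a standing
hypothesis of BDP §4–5 at `(k, c, ε_f) = (2, 1, 𝟙)`: `f` the normalised newform of level `N = N_E` (§4.1), `K`
imaginary quadratic of odd discriminant (Thm. 4.6), the classical Heegner hypothesis with every `q ∣ N` SPLIT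
(stronger than Assumption (1.9); it gives `S(f) = ∅`, p. 37, and `χ = φ𝐍_K ∈ Σ_cc^{(2)}(𝔑)` for unramified `φ`
of type `(n,−n)`, `n ≥ 1` — bsd-eis LIT-DOSSIER §40 (H)(R1b), certified at the page).
RELATION TO THE TREE: (i) implies `bertoliniDarmonPrasanna2013_centralValue_reciprocity` (proved in the consumer
file: apply `σ ∈ Aut(ℂ/F₀)` to the square, `σ(χ_j(𝔞)) = (^σχ)_j(𝔞)` by Weil's `HasInfinityType.autConj`, then
undo the constants `w(f,χ)`, `C(f,χ,1)` with `Ω′⁴ = Ω⁴|d_K|/(4π⁴)`); (ii) is implied by the printed (5.1.16) +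
Prop. 1.12 (1) + (4.1.3) + CFT as explained; (iii) reuses `bdpLalg`/`heckeIdealValueExtZero` verbatim, so the
`L`-value dictionary (R1a) "`L(f,χ⁻¹,0) = rankinSelbergValueHecke f φ 1`" is the sister module's, not re-derived.

## References

* [BertoliniDarmonPrasanna2013] Duke Math. J. 162 (2013): Prop. 1.12 (1) (p. 14), (4.1.3) (p. 34), Thm. 4.6
  (p. 38), §5.1: (5.1.6), Lemma 5.2, (5.1.11), Lemma 5.3, Thm. 5.4 (5.1.12), (5.1.15), Thm. 5.5, (5.1.16)
  (pp. 58–60).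
* [Shimura1975Arith] G. Shimura, *On some arithmetic properties of modular forms of one and several variables*,
  Ann. of Math. 102 (1975) (= [Shim1] of BDP: Part (1) of Prop. 1.12).
* [Cox2013] D. Cox, *Primes of the form x² + ny²*, 2nd ed., Thm. 8.10 / §9.A (`H/K` unramified).
* Sister modules: `DisplayWeightTwo.lean` (bsd-eis; `bdpConstC`, `bdpConstW`, `bdpLalg`),
  `BDPCentralValueReciprocity.lean` (bsd-stepL desc3-p1; the reciprocity consequence, (D1)–(D6)).
-/

noncomputable section

open scoped NumberField
open NumberField IsDedekindDomain
open Literature.NumberTheory.GaloisRepresentations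
open Literature.NumberTheory.EllipticCurves.ModularForms

namespace Literature.NumberTheory.EllipticCurves.BertoliniDarmonPrasanna2013

/-- **Bertolini–Darmon–Prasanna 2013, Thm. 5.4 (5.1.12) / (5.1.16) with Prop. 1.12 (1) (Shimura): the explicit
Waldspurger formula in square-root form, at weight `2` and conductor `1`.** For the newform `f` of level
`N = N_W` of an elliptic curve `W/ℚ` and an imaginary quadratic field `K` of ODD discriminant in which every prime
dividing `N` splits, there are: a period `Ω ≠ 0` ((5.1.15)), the scalars `w_f ≠ 0` (Lemma 5.2) and `b_N ≠ 0` with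
an ideal `𝔟 ≠ 0` ((5.1.6)), the exponent `#S(f)`, and a subfield `F₀ ⊂ ℂ` finite over `ℚ` — the Hilbert class
field of `K` with `i` adjoined (module docstring) — containing `K`, `i`, `w_f`, `b_N` and unramified above every
odd rational prime split in `K`, such that FOR EVERY `n ≥ 1` there are finitely many integral ideals `𝔞` of `K`
and `χ`-FREE coefficients `V_𝔞 ∈ F₀` (in print: representatives of `Pic(𝒪_K)` and the CM values
`Θ^{n−1}_Hodge f(𝔞 ∗ (A₀,t₀,ω₀))`) with, for every everywhere-unramified Hecke character `φ` of `K` of infinity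
type `(n, −n)` (BDP's `χ = φ𝐍_K ∈ Σ_cc^{(2)}(𝔑)` of type `(2+j, −j)`, `j = n−1`, `χ_j(𝔞) = φ(𝔞)·N𝔞^n`):

  `L_alg(f,χ⁻¹,0) = (∑_𝔞 χ_j(𝔞)⁻¹ · V_𝔞)²`,

`L_alg` being the sister module's `bdpLalg f #S(f) w_f 𝔟 N b_N Ω φ n = w(f,χ)⁻¹C(f,χ,1)L(f/K,φ,1)/Ω^{4n}`
(Thm. 5.5's definition, typed verbatim by bsd-eis) and `φ(𝔞) = heckeIdealValueExtZero φ 𝔞` ((4.1.5)).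
Existentially weakened from the printed formula (family and auxiliary data ∃-quantified); a `Prop`, NOT asserted
(named fact). -- TODO(general form): weight `k`, nebentypus `ε_f`, conductor `c > 1`, and the CM values as
DEFINED objects `Θ^j_Hodge f(𝔞 ∗ (A₀,t₀,ω₀))` (Shimura–Maass / Hodge-splitting front).
[cite: BertoliniDarmonPrasanna2013, Thm. 5.4 (5.1.12) (p. 59), (5.1.15)–(5.1.16) and Thm. 5.5 with its proof (p. 60), Prop. 1.12 (1) (p. 14), (4.1.3) (p. 34)]
[cite: Shimura1975Arith, Part (1) of BDP Prop. 1.12]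
[cite: Cox2013, Thm. 8.10 and §9.A (the Hilbert class field is unramified over K)] -/
def thm54_bdpLalg_eq_sq_sum_cmValues : Prop :=
  ∀ (W : WeierstrassCurve ℚ) [W.IsElliptic] (K : Type) [Field K] [NumberField K] {N : ℕ} [NeZero N]
    (f : CuspForm (CongruenceSubgroup.Gamma0 N) 2),
    IsNewformOf W f → W.conductorNorm ℤ = N → IsImaginaryQuadratic K → Odd (NumberField.discr K) →
    SatisfiesHeegnerHypothesis N K →
    ∃ (Ω wf bN : ℂ) (𝔟 : Ideal (𝓞 K)) (sf : ℕ) (F : IntermediateField ℚ ℂ),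
      Ω ≠ 0 ∧ wf ≠ 0 ∧ bN ≠ 0 ∧ 𝔟 ≠ ⊥ ∧ FiniteDimensional ℚ F ∧
      (∀ (e : K →+* ℂ) (k : K), e k ∈ F) ∧ Complex.I ∈ F ∧ wf ∈ F ∧ bN ∈ F ∧
      (∀ ℓ : ℕ, ℓ.Prime → ℓ ≠ 2 → ((Ideal.span {(ℓ : ℤ)}).primesOver (𝓞 K)).ncard = 2 →
        ∀ P : Ideal (𝓞 F), P.IsPrime → ((ℓ : ℕ) : 𝓞 F) ∈ P → P.ramificationIdx (𝓞 ℚ) = 1) ∧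
      ∀ n : ℕ, 0 < n →
        ∃ (A : Finset (Ideal (𝓞 K))) (V : Ideal (𝓞 K) → ℂ), (∀ 𝔞 ∈ A, V 𝔞 ∈ F) ∧
          ∀ (φ : HeckeCharacter K), (∀ v : HeightOneSpectrum (𝓞 K), φ.IsUnramifiedAt v) →
            φ.HasInfinityType (fun _ ↦ (n : ℤ)) (fun _ ↦ -(n : ℤ)) →
            bdpLalg f sf wf 𝔟 N bN Ω φ n =
              (∑ 𝔞 ∈ A, (heckeIdealValueExtZero φ 𝔞 * ((Ideal.absNorm 𝔞 : ℕ) : ℂ) ^ n)⁻¹ * V 𝔞) ^ 2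

end Literature.NumberTheory.EllipticCurves.BertoliniDarmonPrasanna2013

end
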